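import Literature.MathematicalPhysics.QuantumFieldTheory.Balaban1983to89.Beta.TorusKKTUniqueness

/-!
# The one-block torus instance of the KKT uniqueness theorem: cochains on `(ℤ/Nℤ)^d`, straight-contour block sum,
# full codifferential gauge — everything discharged except the cohomological input (Hdg)

HONEST FRAMING (binding, verbatim): "discharging BetaPertH makes Balaban's UV stability UNCONDITIONAL — a real
constructive-QFT result; it is NOT the continuum limit and NOT the Clay problem."  This module is NOT summit progress.

WHAT THIS FILE IS.  [folklore] finite-dimensional linear algebra on the discrete torus `𝕋 = Fin d → ZMod N`; every
cochain space is a `EuclideanSpace ℝ _` (sum-of-products inner product); nothing of Bałaban's manuscripts is asserted.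
It INSTANTIATES the abstract `Beta.TorusKKTUniqueness.torus_uniqueness` (sibling module) on ONE averaging block with
periodic identifications — the «k ≡ 0 fibre» of the infinite-volume problem — and discharges all of its hypotheses but one:
* `d0` (gradient of 0-cochains), `d1` (lattice curvature of 1-cochains, all ordered pairs, as in `Beta.AffineAveraging.curv`)
  are EXPLICIT linear maps; the codifferentials are `LinearMap.adjoint d0`, `LinearMap.adjoint d1` (so the adjointness
  hypotheses `hadj0/hadj1/hadjQ` of the abstract theorem hold by `LinearMap.adjoint_inner_right`);
* `Q` = the straight-contour block sum of a 1-cochain over the one block (`Σ_x Σ_{s<N} D κ (x + s•e_κ)`), which on the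
  one-block torus is `N •` the total sum of the component (`blockSum_eq`); (Qd) `Q (d0 λ) = 0` (`Q_d0`: telescoping
  around the torus) and (Qc) `Q (const c) = 0 → const c = 0` (`Q_const`, `const_eq_zero_of_Q`) are PROVED;
* the gauge operator is `R = id`: on one block `N(Q′) ⊕ ℝ·1` is every 0-cochain and the Laplacian kills constants, so the
  projected gauge condition `R δ D = 0` of the infinite-volume problem IS the full condition `δ D = 0` — recorded as
  `total_adjoint_d0_eq_zero` (the codifferential of any 1-cochain has total sum zero, i.e. is already orthogonal to the
  constants); (RΔ) is then trivial;
* (Hdg) — «a 1-cochain with zero curvature is a constant cochain plus a gradient» (H¹ of the cubical torus is represented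
  by constants) — is KEPT AS THE ONE HYPOTHESIS `Hdg d N` (it is periodic cochain cohomology, supplied elsewhere).
MAIN THEOREM `oneBlock_uniqueness`: `Hdg d N →` (stationarity `adjoint d1 (d1 D) = adjoint Q φ + d0 ψ`) `→ Q D = 0 →
adjoint d0 D = 0 → D = 0`; and `oneBlock_kkt_trivial` adds `φ = 0 ∧ d0 ψ = 0` (`adjoint Q` is injective because `Q` is
onto: `Q (const c) = N^(d+1) • c`).

CONTEXT (locators only; nothing used): the constrained minimisation [Balaban1985Variational] p. 285 (45); the projected
gauge condition with R the orthogonal projection onto Δ(N(Q′)) [Balaban1985BackgroundPropagators] p. 394 (3.21); the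
straight-contour average [Balaban1984PropagatorsI] p. 19 (1.11).  Prose: HOME/BETA/AN2.md §11 (Y12)(b) (B4), (Y13).
-/

namespace Literature.MathematicalPhysics.QuantumFieldTheory.Balaban1983to89.Beta.OneBlockTorusKKT

open scoped InnerProductSpace
open TorusKKTUniqueness

variable (d N : ℕ) [NeZero N]

/-- The one-block discrete torus `(ℤ/Nℤ)^d`. [folklore] -/
abbrev 𝕋 : Type := Fin d → ZMod N

/-- 0-cochains (scalar fields) on the torus, with the ℓ² inner product. [folklore] -/
abbrev C0 : Type := EuclideanSpace ℝ (𝕋 d N)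
/-- 1-cochains (one component per direction and site). [folklore] -/
abbrev C1 : Type := EuclideanSpace ℝ (Fin d × 𝕋 d N)
/-- 2-cochains indexed by ORDERED pairs of directions (as `AffineAveraging.curv`). [folklore] -/
abbrev C2 : Type := EuclideanSpace ℝ ((Fin d × Fin d) × 𝕋 d N)
/-- Coarse data on one block: one number per direction. [folklore] -/
abbrev W : Type := EuclideanSpace ℝ (Fin d)

variable {d N}

/-- The unit vector `e_κ` of the torus. [folklore] -/
def e (κ : Fin d) : 𝕋 d N := Pi.single κ 1

/-- Build an element of a `EuclideanSpace` from its coordinate function. [folklore] -/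
def mk {α : Type*} (f : α → ℝ) : EuclideanSpace ℝ α := (WithLp.equiv 2 (α → ℝ)).symm f

/-- Coordinates of `mk f`. [folklore] -/
@[simp] theorem mk_apply {α : Type*} (f : α → ℝ) (a : α) : mk f a = f a := rfl

/-- **d0**: the gradient `(d0 λ) (κ, x) = λ (x + e_κ) − λ x`. [folklore] -/
noncomputable def d0 : C0 d N →ₗ[ℝ] C1 d N where
  toFun l := mk fun p => l (p.2 + e p.1) - l p.2
  map_add' a b := by ext p; simp; ring
  map_smul' t a := by ext p; simp; ring

omit [NeZero N] in
/-- Entries of `d0`. [folklore] -/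
@[simp] theorem d0_apply (l : C0 d N) (κ : Fin d) (x : 𝕋 d N) : d0 l (κ, x) = l (x + e κ) - l x := rfl

/-- **d1**: the lattice curvature `(d1 D) ((κ,l), x) = D κ x + D l (x + e_κ) − D κ (x + e_l) − D l x`. [folklore] -/
noncomputable def d1 : C1 d N →ₗ[ℝ] C2 d N where
  toFun D := mk fun p => D (p.1.1, p.2) + D (p.1.2, p.2 + e p.1.1) - D (p.1.1, p.2 + e p.1.2) - D (p.1.2, p.2)
  map_add' a b := by ext p; simp; ring
  map_smul' t a := by ext p; simp; ring

omit [NeZero N] in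
/-- Entries of `d1`. [folklore] -/
@[simp] theorem d1_apply (D : C1 d N) (κ l : Fin d) (x : 𝕋 d N) :
    d1 D ((κ, l), x) = D (κ, x) + D (l, x + e κ) - D (κ, x + e l) - D (l, x) := rfl

omit [NeZero N] in
/-- `d1 ∘ d0 = 0` (curvature of a gradient vanishes). [folklore] -/
theorem d1_d0 (l : C0 d N) : d1 (d0 l) = 0 := by
  ext ⟨⟨κ, μ⟩, x⟩
  simp only [d1_apply, d0_apply, PiLp.zero_apply]
  rw [add_right_comm x (e κ) (e μ)]
  ring

/-- The CONSTANT 1-cochain with value `c κ` in direction `κ`. [folklore] -/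
noncomputable def const : W d →ₗ[ℝ] C1 d N where
  toFun c := mk fun p => c p.1
  map_add' a b := by ext p; simp
  map_smul' t a := by ext p; simp

omit [NeZero N] in
/-- Entries of `const`. [folklore] -/
@[simp] theorem const_apply (c : W d) (κ : Fin d) (x : 𝕋 d N) : const c (κ, x) = c κ := rfl

/-- **Q**: the straight-contour block sum over the one block, `(Q D) κ = Σ_x Σ_{s<N} D κ (x + s • e_κ)` (unnormalised, as in
`Beta.AffineAveraging.contourSum` with the block = the whole torus). [folklore] -/
noncomputable def Q : C1 d N →ₗ[ℝ] W d where
  toFun D := mk fun κ => ∑ x : 𝕋 d N, ∑ s ∈ Finset.range N, D (κ, x + (s : ℤ) • e κ)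
  map_add' a b := by
    ext κ; simp only [mk_apply, PiLp.add_apply, Finset.sum_add_distrib]
  map_smul' t a := by
    ext κ; simp only [mk_apply, PiLp.smul_apply, smul_eq_mul, RingHom.id_apply, Finset.mul_sum]

/-- Entries of `Q`. [folklore] -/
theorem Q_apply (D : C1 d N) (κ : Fin d) : Q D κ = ∑ x : 𝕋 d N, ∑ s ∈ Finset.range N, D (κ, x + (s : ℤ) • e κ) := rfl

/-- On the one-block torus every contour point is visited `N` times: `(Q D) κ = N • Σ_x D κ x`. [folklore] -/
theorem blockSum_eq (D : C1 d N) (κ : Fin d) : Q D κ = (N : ℝ) * ∑ x : 𝕋 d N, D (κ, x) := by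
  rw [Q_apply, Finset.sum_comm]
  have h : ∀ s ∈ Finset.range N, ∑ x : 𝕋 d N, D (κ, x + (s : ℤ) • e κ) = ∑ x : 𝕋 d N, D (κ, x) := by
    intro s _
    exact Fintype.sum_equiv (Equiv.addRight ((s : ℤ) • e κ)) _ _ (fun x => rfl)
  rw [Finset.sum_congr rfl h, Finset.sum_const, Finset.card_range, nsmul_eq_mul]

/-- **(Qd)**: the block sum of a gradient vanishes (telescoping around the torus). [folklore] -/
theorem Q_d0 (l : C0 d N) : Q (d0 l) = 0 := by
  ext κ
  rw [blockSum_eq, PiLp.zero_apply]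
  have h : ∑ x : 𝕋 d N, d0 l (κ, x) = 0 := by
    simp only [d0_apply, Finset.sum_sub_distrib]
    rw [Fintype.sum_equiv (Equiv.addRight (e κ)) (fun x => l (x + e κ)) (fun x => l x) (fun x => rfl), sub_self]
  rw [h, mul_zero]

/-- The block sum of a constant cochain: `Q (const c) = N^(d+1) • c`. [folklore] -/
theorem Q_const (c : W d) : Q (const c : C1 d N) = ((N : ℝ) ^ (d + 1)) • c := by
  ext κ
  rw [blockSum_eq, PiLp.smul_apply, smul_eq_mul]
  simp only [const_apply, Finset.sum_const, Finset.card_univ, nsmul_eq_mul]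
  rw [Fintype.card_pi, Finset.prod_const, Finset.card_univ, Fintype.card_fin, ZMod.card]
  push_cast
  ring

/-- **(Qc)**: the block sum sees constants — `Q (const c) = 0 → const c = 0`. [folklore] -/
theorem const_eq_zero_of_Q (c : W d) (h : Q (const c : C1 d N) = 0) : (const c : C1 d N) = 0 := by
  rw [Q_const] at h
  have hN : ((N : ℝ) ^ (d + 1)) ≠ 0 := pow_ne_zero _ (Nat.cast_ne_zero.2 (NeZero.ne N))
  have hc : c = 0 := by
    rcases smul_eq_zero.1 h with h' | h'
    · exact absurd h' hN
    · exact h'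
  rw [hc, map_zero]

/-- `Q` is onto (so `adjoint Q` is injective): `Q (const (N^{-(d+1)} • b)) = b`. [folklore] -/
theorem Q_surjective : Function.Surjective (Q : C1 d N →ₗ[ℝ] W d) := by
  intro b
  refine ⟨const ((((N : ℝ) ^ (d + 1))⁻¹) • b), ?_⟩
  have hN : ((N : ℝ) ^ (d + 1)) ≠ 0 := pow_ne_zero _ (Nat.cast_ne_zero.2 (NeZero.ne N))
  rw [map_smul, map_smul, Q_const, smul_smul, inv_mul_cancel₀ hN, one_smul]

/-- `adjoint Q` is injective. [folklore] -/
theorem adjoint_Q_injective : Function.Injective (LinearMap.adjoint (Q : C1 d N →ₗ[ℝ] W d)) := by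
  intro φ₁ φ₂ h
  have key : ∀ b : W d, ⟪b, φ₁ - φ₂⟫_ℝ = 0 := by
    intro b
    obtain ⟨D, rfl⟩ := Q_surjective (d := d) (N := N) b
    rw [inner_sub_right, ← LinearMap.adjoint_inner_right, ← LinearMap.adjoint_inner_right, h, sub_self]
  have := key (φ₁ - φ₂)
  rwa [inner_self_eq_zero, sub_eq_zero] at this

/-- **ONE BLOCK: THE PROJECTED GAUGE CONDITION IS THE FULL ONE.**  The codifferential `adjoint d0 D` of any 1-cochain has
total sum zero — it is already orthogonal to the constants, so the projection `R` onto `Δ(N(Q′)) = (constants)^⊥` acts on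
it as the identity. [folklore] -/
theorem total_adjoint_d0_eq_zero (D : C1 d N) : ∑ x : 𝕋 d N, (LinearMap.adjoint d0 D) x = 0 := by
  have h1 : d0 (mk fun _ : 𝕋 d N => (1 : ℝ) : C0 d N) = 0 := by
    ext ⟨κ, x⟩; simp
  have h : ⟪(mk fun _ : 𝕋 d N => (1 : ℝ) : C0 d N), LinearMap.adjoint d0 D⟫_ℝ = 0 := by
    rw [LinearMap.adjoint_inner_right, h1, inner_zero_left]
  rw [PiLp.inner_apply] at h
  simpa using h

/-- **(Hdg) — THE ONE HYPOTHESIS KEPT**: a 1-cochain on the one-block torus with zero lattice curvature is a constant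
cochain plus a gradient (H¹ of the cubical torus `(ℤ/Nℤ)^d` is represented by constants; periodic cochain cohomology,
supplied elsewhere). [folklore] -/
def Hdg (d N : ℕ) [NeZero N] : Prop :=
  ∀ D : C1 d N, d1 D = 0 → ∃ c : W d, ∃ l : C0 d N, D = const c + d0 l

/-- **ONE-BLOCK TORUS UNIQUENESS**: under (Hdg), a 1-cochain `D` that is stationary with multipliers
(`δ1 d1 D = Qᵀ φ + d0 ψ`), has zero block sum (`Q D = 0`) and is in the codifferential gauge (`δ0 D = 0`) vanishes.
[folklore] -/
theorem oneBlock_uniqueness (hH : Hdg d N) {D : C1 d N} {φ : W d} {ψ : C0 d N}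
    (hstat : LinearMap.adjoint d1 (d1 D) = LinearMap.adjoint Q φ + d0 ψ)
    (hQ : Q D = 0) (hg : LinearMap.adjoint d0 D = 0) : D = 0 := by
  have hstat' : LinearMap.adjoint d1 (d1 D) =
      LinearMap.adjoint Q φ + d0 ((LinearMap.id : C0 d N →ₗ[ℝ] C0 d N) ψ) := hstat
  refine torus_uniqueness (V0 := C0 d N) (V1 := C1 d N) (V2 := C2 d N) (W := W d)
    d0 (LinearMap.adjoint d0) (fun l D => (LinearMap.adjoint_inner_right d0 l D).symm)
    d1 (LinearMap.adjoint d1) (fun D F => (LinearMap.adjoint_inner_right d1 D F).symm)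
    Q (LinearMap.adjoint Q) (fun D φ => (LinearMap.adjoint_inner_right Q D φ).symm)
    (LinearMap.id : C0 d N →ₗ[ℝ] C0 d N) (fun a b => rfl) (LinearMap.range (const : W d →ₗ[ℝ] C1 d N)) ?_ ?_
    (Q_d0 (d := d) (N := N)) (fun l => rfl) hstat' hQ ?_
  · intro D hD
    obtain ⟨c, l, h⟩ := hH D hD
    exact ⟨const c, LinearMap.mem_range_self _ c, l, h⟩
  · rintro _ ⟨c, rfl⟩ hc
    exact const_eq_zero_of_Q c hc
  · simpa using hg

/-- … and the multipliers are trivial: `φ = 0` and `d0 ψ = 0` — the one-block (k = 0) KKT matrix is injective. [folklore] -/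
theorem oneBlock_kkt_trivial (hH : Hdg d N) {D : C1 d N} {φ : W d} {ψ : C0 d N}
    (hstat : LinearMap.adjoint d1 (d1 D) = LinearMap.adjoint Q φ + d0 ψ)
    (hQ : Q D = 0) (hg : LinearMap.adjoint d0 D = 0) : D = 0 ∧ φ = 0 ∧ d0 ψ = 0 := by
  have hD : D = 0 := oneBlock_uniqueness hH hstat hQ hg
  have hsum : LinearMap.adjoint Q φ + d0 ψ = 0 := by rw [← hstat, hD, map_zero, map_zero]
  obtain ⟨hQt, hψ⟩ := multipliers_exact_part_zero (V0 := C0 d N) (V1 := C1 d N) (W := W d) d0 Q (LinearMap.adjoint Q)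
    (fun D φ => (LinearMap.adjoint_inner_right Q D φ).symm) (Q_d0 (d := d) (N := N)) hsum
  refine ⟨hD, adjoint_Q_injective (d := d) (N := N) ?_, hψ⟩
  rw [hQt, map_zero]

/-! ## Examples -/

/-- `d = 1`, `N = 3`: the block sum of the constant cochain `1` is `3² = 9` in the one direction. [folklore] -/
example : Q (const (mk fun _ : Fin 1 => (1 : ℝ)) : C1 1 3) 0 = 9 := by
  have h := congrArg (fun v : W 1 => v 0) (Q_const (d := 1) (N := 3) (mk fun _ : Fin 1 => (1 : ℝ)))
  simp only [PiLp.smul_apply, mk_apply, smul_eq_mul, mul_one] at h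
  rw [h]; norm_num

end Literature.MathematicalPhysics.QuantumFieldTheory.Balaban1983to89.Beta.OneBlockTorusKKT
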